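import Summits.ValiantsHypothesis.ValiantsHypothesis.Theorems.GrenetZeonDualUnipotentThreeHalvesLongMassValueSpaceFree
import Summits.ValiantsHypothesis.ValiantsHypothesis.Theorems.GrenetZeonDualUnipotentThreeHalvesLongMassLedgerIndexShadowSpace

/-!
# `GrenetZeon.DualUnipotentThreeHalves` (stmt-ValiantsHypothesis-24318), line `slow_core`, stub (c) `SlowCore.LongMassSlowLawInv`:
# THE COORDINATE-FREE FORM — (c) is a statement about NILPOTENT SUBMODULES of `M_b(ℂ)`

Capstone of this hand's normal-form files (✓ `…LongMassHomogenise`: constant part free; `…LongMassValueSpace{,Mono,Free,FreeIff}`: the price is a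
monotone invariant of the value space, free re-parametrisation).  Here the pencil disappears altogether:

★★★ `longMassSlowLawInv_iff_submodule` —
`SlowCore.LongMassSlowLawInv ↔ ∃ c n₀, ∀ n ≥ n₀, ∀ b, ∀ V ≤ M_b(ℂ)` (a `Submodule ℂ`) with `dim V ≤ n²` and `A ^ b = 0` for all `A ∈ V`,
`∃ W ≤ V, ∃ k,` [WINDOW: for all `A ∈ V`, `w ∈ W`, `p ≤ n − 1`, every entry of `(A + s·w)^p` has `s`-degree `≤ k`] `∧ n·k + (dim V − dim W) ≤ c·√n·b`.

(The window polynomial is written, exactly as in `SlowCore.Ledger`, in `MvPolynomial (Fin 1) ℂ`: `A.map C + X 0 • w.map C`.)  Same constants as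
the linear form (`longMassSlowLawAll_iff_linear`); relative to `LongMassSlowLawInv` the round trip costs `c ↦ 2(c+10)`-type constants only through
the already-landed equivalences.

Proof.  (⇐) For a LINEAR pencil `B` with linear-part map `T` (✓ `LedgerIndex.exists_linearMap_linMat`) take `V := range T`; its members are
the point values `B(x)` (✓ `map_eval_eq_linMat_of_linear`), so `V` is nilpotent; given `(W, k)` put `K := T⁻¹ W`: the line `B(x + s v) = (T x) + s·(T v)`
(`map_lineSubst_eq_add_smul`) turns the window into the ledger, and `codim K = dim V − dim W` EXACTLY (`codim_comap_eq`).  Then ✓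
`longMassSlowLawAll_of_linear` / ✓ `inv_of_all`.  (⇒) Given `V`, place a `Module.finBasis` of `V` on distinct coordinates (`dim V ≤ n²`): a linear
pencil `N₁` with `range T₁ = V` (`exists_linear_of_submodule`), nilpotent because its values lie in `V`; a certificate `(K₁, k)` of `N₁` (✓
`all_of_inv`) gives `W := T₁ K₁` with `dim V − dim W ≤ codim K₁` (✓ `LedgerIndex.codim_map_le_codim`).

Honest framing.  A REFORMULATION (`--supports stmt-ValiantsHypothesis-24318`), NOT progress on (c): (c) `SlowCore.LongMassSlowLawInv`, S3, the crux
24318, 8062 and `VP ≠ VNP` remain OPEN / NOT proved.  No sorry, no definitions, no named facts.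
-/

-- single-conjunct layout: Sub = Summit, duplicated namespace component intended (the name is mandated)
set_option linter.dupNamespace false
set_option autoImplicit false

noncomputable section

namespace Summit.ValiantsHypothesis.ValiantsHypothesis.Theorems.GrenetZeon.LongMassHomogenise

open MvPolynomial Matrix
open scoped BigOperators
open Summit.ValiantsHypothesis.ValiantsHypothesis.Cruxes.TwoDimCoefficients.DimTwoCases (AffMat IsAffine)
open Summit.ValiantsHypothesis.ValiantsHypothesis.Theorems.GrenetZeon.RadicalSplit (lineSubst)
open Summit.ValiantsHypothesis.ValiantsHypothesis.Theorems.GrenetZeon.SlowCore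
open Summit.ValiantsHypothesis.ValiantsHypothesis.Theorems.GrenetZeon.ResolventFlag (linMat)
open Summit.ValiantsHypothesis.ValiantsHypothesis.Theorems.GrenetZeon.LedgerIndex (exists_linearMap_linMat codim_map_le_codim)
open Summit.ValiantsHypothesis.ValiantsHypothesis.Theorems.GrenetZeon.LongMassIrreducibilityFree
  (LongMassSlowLawAll inv_of_all all_of_inv)

variable {n b : ℕ}

/-! ## §1 Linear pencils: values, lines, exact codimension count -/

/-- The line of a LINEAR pencil: `N(x + s v) = lin x + s · lin v` (as a matrix over `ℂ[s] = MvPolynomial (Fin 1) ℂ`). -/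
theorem map_lineSubst_eq_add_smul (N : AffMat n b) (hN : IsAffine N) (h0 : ∀ i j, coeff 0 (N i j) = 0)
    (x v : Fin n × Fin n → ℂ) :
    N.map (lineSubst x v) = (linMat N x).map (C : ℂ → MvPolynomial (Fin 1) ℂ) + (X 0 : MvPolynomial (Fin 1) ℂ) • (linMat N v).map C := by
  refine Matrix.ext fun i j => ?_
  have he : eval x (N i j) = linEntry N i j x := by
    rw [eval_eq_of_totalDegree_le_one _ (hN i j), h0, zero_add, linEntry]
    exact Finset.sum_congr rfl fun e _ => mul_comm _ _
  rw [Matrix.map_apply, lineSubst_apply_of_le_one N hN, Matrix.add_apply, Matrix.map_apply, Matrix.smul_apply,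
    Matrix.map_apply, smul_eq_mul, he, mul_comm (X 0 : MvPolynomial (Fin 1) ℂ)]
  rfl

/-- EXACT CODIMENSION COUNT: for `W ≤ range T`, `codim T⁻¹ W = dim (range T) − dim W`. -/
theorem codim_comap_eq (T : (Fin n × Fin n → ℂ) →ₗ[ℂ] Matrix (Fin b) (Fin b) ℂ) (W : Submodule ℂ (Matrix (Fin b) (Fin b) ℂ))
    (hW : W ≤ LinearMap.range T) :
    n * n - Module.finrank ℂ (W.comap T) = Module.finrank ℂ (LinearMap.range T) - Module.finrank ℂ W := by
  set K := W.comap T with hK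
  have hV : Module.finrank ℂ (Fin n × Fin n → ℂ) = n * n := by
    rw [Module.finrank_pi, Fintype.card_prod, Fintype.card_fin]
  have hmap : K.map T = W := by
    rw [hK, Submodule.map_comap_eq]; exact inf_eq_right.mpr hW
  have h2 := LinearMap.finrank_range_add_finrank_ker (T ∘ₗ K.subtype)
  have hrangeK : LinearMap.range (T ∘ₗ K.subtype) = K.map T := by
    rw [LinearMap.range_comp, Submodule.range_subtype]
  have hkerle : LinearMap.ker T ≤ K := by
    intro z hz
    rw [hK, Submodule.mem_comap, LinearMap.mem_ker.mp hz]
    exact W.zero_mem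
  have hkerK : Module.finrank ℂ (LinearMap.ker (T ∘ₗ K.subtype)) = Module.finrank ℂ (LinearMap.ker T) := by
    rw [LinearMap.ker_comp]
    exact (Submodule.comapSubtypeEquivOfLe hkerle).finrank_eq
  rw [hrangeK, hmap, hkerK, Module.finrank_eq_card_basis (Module.finBasis ℂ K), Fintype.card_fin] at h2
  have h1 := LinearMap.finrank_range_add_finrank_ker T
  rw [hV] at h1
  have hWr : Module.finrank ℂ W ≤ Module.finrank ℂ (LinearMap.range T) := Submodule.finrank_mono hW
  omega

/-! ## §2 A linear pencil with a prescribed value space -/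

/-- ★ Every submodule `V ≤ M_b(ℂ)` with `dim V ≤ n²` is the value space of a LINEAR affine pencil over the `n²` coordinates
(a `Module.finBasis` of `V` placed on distinct coordinates). -/
theorem exists_linear_of_submodule (V : Submodule ℂ (Matrix (Fin b) (Fin b) ℂ)) (hV : Module.finrank ℂ V ≤ n * n) :
    ∃ N₁ : AffMat n b, IsAffine N₁ ∧ (∀ i j, coeff 0 (N₁ i j) = 0) ∧
      (∀ y, linMat N₁ y ∈ V) ∧ (∀ A ∈ V, ∃ y, linMat N₁ y = A) := by
  classical
  set r := Module.finrank ℂ V with hr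
  let B := Module.finBasis ℂ V
  have hrn : r ≤ Fintype.card (Fin n × Fin n) := by rwa [Fintype.card_prod, Fintype.card_fin]
  let φ : Fin r ↪ Fin n × Fin n := (Fin.castLEEmb hrn).trans (Fintype.equivFin (Fin n × Fin n)).symm.toEmbedding
  let M : Fin r → Matrix (Fin b) (Fin b) ℂ := fun t => (B t : Matrix (Fin b) (Fin b) ℂ)
  let N₁ : AffMat n b := Matrix.of fun i j => ∑ t, C (M t i j) * X (φ t)
  have hN₁ : ∀ i j, N₁ i j = ∑ t, C (M t i j) * X (φ t) := fun i j => rfl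
  have haff : IsAffine N₁ := by
    intro i j
    rw [hN₁ i j]
    refine (totalDegree_finsetSum _ _).trans (Finset.sup_le fun t _ => ?_)
    exact (totalDegree_mul _ _).trans (by rw [totalDegree_C, totalDegree_X, zero_add])
  have h0₁ : ∀ i j, coeff 0 (N₁ i j) = 0 := by
    intro i j
    rw [hN₁ i j, coeff_sum]
    simp [coeff_C_mul]
  have hval : ∀ v, linMat N₁ v = ∑ t, v (φ t) • M t := by
    intro v
    rw [← map_eval_eq_linMat_of_linear N₁ haff h0₁ v]
    ext i j
    rw [Matrix.map_apply, hN₁ i j]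
    simp [eval_X, Matrix.sum_apply, mul_comm]
  have hcoe : ∀ c : Fin r → ℂ, (∑ t, c t • M t) = ((∑ t, c t • B t : V) : Matrix (Fin b) (Fin b) ℂ) := by
    intro c
    rw [Submodule.coe_sum]
    exact Finset.sum_congr rfl fun t _ => by rw [Submodule.coe_smul]
  refine ⟨N₁, haff, h0₁, fun y => ?_, fun A hA => ?_⟩
  · rw [hval, hcoe]; exact ((∑ t, y (φ t) • B t : V)).2
  · set c : Fin r → ℂ := fun t => B.repr ⟨A, hA⟩ t with hc
    refine ⟨Function.extend φ c 0, ?_⟩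
    rw [hval]
    have hrepr : (∑ t, c t • B t : V) = ⟨A, hA⟩ := by simp [hc]
    have : (∑ t, Function.extend φ c (0 : Fin n × Fin n → ℂ) (φ t) • M t) = ∑ t, c t • M t :=
      Finset.sum_congr rfl fun t _ => by rw [φ.injective.extend_apply]
    rw [this, hcoe, hrepr]

/-! ## §3 (c) in coordinate-free form -/

/-- ★★★ **(c) ⟺ ITS COORDINATE-FREE FORM FOR THE LINEAR LAW.**  The linear form of (c) (✓ `longMassSlowLawAll_iff_linear`) is equivalent, with
the SAME constants, to the statement about nilpotent submodules of `M_b(ℂ)`. -/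
theorem longMassSlowLawAll_linear_iff_submodule (c n₀ : ℕ) :
    (∀ n ≥ n₀, ∀ b : ℕ, ∀ B : AffMat n b, IsAffine B → (∀ i j, coeff 0 (B i j) = 0) → B ^ b = 0 →
        RelCert n b B (c * (Nat.sqrt n * b))) ↔
    (∀ n ≥ n₀, ∀ b : ℕ, ∀ V : Submodule ℂ (Matrix (Fin b) (Fin b) ℂ),
      Module.finrank ℂ V ≤ n * n → (∀ A ∈ V, A ^ b = 0) →
      ∃ (W : Submodule ℂ (Matrix (Fin b) (Fin b) ℂ)) (k : ℕ), W ≤ V ∧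
        (∀ A ∈ V, ∀ w ∈ W, ∀ p : ℕ, p ≤ n - 1 → ∀ i j : Fin b,
          ((((A.map (C : ℂ → MvPolynomial (Fin 1) ℂ) + (X 0 : MvPolynomial (Fin 1) ℂ) • w.map C) ^ p :
            Matrix (Fin b) (Fin b) (MvPolynomial (Fin 1) ℂ)) i j).totalDegree ≤ k)) ∧
        n * k + (Module.finrank ℂ V - Module.finrank ℂ W) ≤ c * (Nat.sqrt n * b)) := by
  constructor
  · -- pencil law ⇒ submodule law
    intro h n hn b V hV hnilV
    obtain ⟨N₁, haff, h0₁, hmemV, hsurj⟩ := exists_linear_of_submodule (n := n) V hV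
    obtain ⟨T₁, hT₁⟩ := exists_linearMap_linMat N₁
    have hrange : LinearMap.range T₁ = V := by
      apply le_antisymm
      · rintro _ ⟨y, rfl⟩; rw [hT₁]; exact hmemV y
      · intro A hA
        obtain ⟨y, hy⟩ := hsurj A hA
        exact ⟨y, by rw [hT₁, hy]⟩
    -- `N₁` is nilpotent: its values lie in `V`
    have hnil₁ : N₁ ^ b = 0 := by
      refine Matrix.ext fun i j => ?_
      apply MvPolynomial.funext
      intro y
      have hy : (N₁.map (eval y)) ^ b = 0 := by
        rw [map_eval_eq_linMat_of_linear N₁ haff h0₁ y]; exact hnilV _ (hmemV y)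
      have := congr_fun (congr_fun hy i) j
      rw [← Matrix.map_pow, Matrix.map_apply, Matrix.zero_apply] at this
      rw [this, Matrix.zero_apply, map_zero]
    obtain ⟨K₁, k, hK₁, hprice⟩ := h n hn b N₁ haff h0₁ hnil₁
    refine ⟨K₁.map T₁, k, by rw [← hrange]; exact LinearMap.map_le_range, ?_, ?_⟩
    · intro A hA w hw p hp i j
      obtain ⟨x₁, hx₁⟩ := hsurj A hA
      obtain ⟨v₁, hv₁K, hv₁⟩ := Submodule.mem_map.mp hw
      rw [hT₁] at hv₁
      have := hK₁ x₁ v₁ hv₁K p hp i j trivial trivial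
      rwa [map_lineSubst_eq_add_smul N₁ haff h0₁, hx₁, hv₁] at this
    · have h3 := codim_map_le_codim T₁ K₁
      rw [hrange] at h3
      exact le_trans (Nat.add_le_add_left h3 _) hprice
  · -- submodule law ⇒ pencil law
    intro h n hn b B hB h0 hnil
    obtain ⟨T, hT⟩ := exists_linearMap_linMat B
    have hV : Module.finrank ℂ (LinearMap.range T) ≤ n * n := by
      have := LinearMap.finrank_range_le T
      rwa [Module.finrank_fintype_fun_eq_card, Fintype.card_prod, Fintype.card_fin] at this
    have hnilV : ∀ A ∈ LinearMap.range T, A ^ b = 0 := by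
      rintro _ ⟨x, rfl⟩
      rw [hT, ← map_eval_eq_linMat_of_linear B hB h0 x, ← Matrix.map_pow, hnil]
      exact Matrix.map_zero _ (map_zero _)
    obtain ⟨W, k, hWle, hwin, hprice⟩ := h n hn b (LinearMap.range T) hV hnilV
    refine ⟨W.comap T, k, ?_, ?_⟩
    · intro x v hv p hp i j _ _
      rw [map_lineSubst_eq_add_smul B hB h0]
      have hvW : linMat B v ∈ W := by rw [← hT]; exact Submodule.mem_comap.mp hv
      exact hwin (linMat B x) (by rw [← hT]; exact LinearMap.mem_range_self T x) (linMat B v) hvW p hp i j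
    · rw [codim_comap_eq T W hWle]; exact hprice

/-- ★★★ **(c) IS A STATEMENT ABOUT NILPOTENT SUBMODULES OF `M_b(ℂ)`**: the registered stub `SlowCore.LongMassSlowLawInv` holds iff for some
`c, n₀`, every nilpotent `V ≤ M_b(ℂ)` with `dim V ≤ n²` (`n ≥ n₀`) has a sub-module `W ≤ V` and an order `k` with the WINDOW property (all
entries of `(A + s w)^p`, `A ∈ V`, `w ∈ W`, `p ≤ n − 1`, of `s`-degree `≤ k`) and `n·k + (dim V − dim W) ≤ c·√n·b`. -/
theorem longMassSlowLawInv_iff_submodule :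
    LongMassSlowLawInv ↔
      ∃ c n₀ : ℕ, ∀ n ≥ n₀, ∀ b : ℕ, ∀ V : Submodule ℂ (Matrix (Fin b) (Fin b) ℂ),
        Module.finrank ℂ V ≤ n * n → (∀ A ∈ V, A ^ b = 0) →
        ∃ (W : Submodule ℂ (Matrix (Fin b) (Fin b) ℂ)) (k : ℕ), W ≤ V ∧
          (∀ A ∈ V, ∀ w ∈ W, ∀ p : ℕ, p ≤ n - 1 → ∀ i j : Fin b,
            ((((A.map (C : ℂ → MvPolynomial (Fin 1) ℂ) + (X 0 : MvPolynomial (Fin 1) ℂ) • w.map C) ^ p :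
            Matrix (Fin b) (Fin b) (MvPolynomial (Fin 1) ℂ)) i j).totalDegree ≤ k)) ∧
          n * k + (Module.finrank ℂ V - Module.finrank ℂ W) ≤ c * (Nat.sqrt n * b) := by
  rw [longMassSlowLawInv_iff_linear]
  constructor
  · rintro ⟨c, n₀, h⟩
    exact ⟨c, n₀, (longMassSlowLawAll_linear_iff_submodule c n₀).mp h⟩
  · rintro ⟨c, n₀, h⟩
    exact ⟨c, n₀, (longMassSlowLawAll_linear_iff_submodule c n₀).mpr h⟩

end Summit.ValiantsHypothesis.ValiantsHypothesis.Theorems.GrenetZeon.LongMassHomogenise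

end
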